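import Literature.AlgebraicGeometry.ShimuraVarieties.UnitaryBallCauchyRiemann
import Literature.NumberTheory.Automorphic.WeightFormsArchRestriction
import HarnessLib

/-!
# Holomorphy of cotangent-weight forms on `U(2,1)`: the first-order criterion, weight-form and adelic forms

`UnitaryBallCauchyRiemann` proves the Cauchy–Riemann criterion for a cotangent-weight FUNCTION on the
complex 2-ball in exponential `𝔭`-coordinates: `F ∈ holomorphic` as soon as, for every `g ∈ U(2,1)`, the
group function `b ↦ f(g · expP b)` (`f = toGroupFun cotangentCocycle x₀ F`, `expP b = exp X_b`,
`X_b ∈ 𝔭 ⊂ 𝔲(2,1)`) is REAL-differentiable at `b = 0` with COMPLEX-LINEAR differential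
(`BallForms.mem_holomorphic_of_cauchyRiemann`).  This file restates that FIRST-ORDER criterion (one
derivative at one point per group element; no smoothness in the other directions of `𝔲(2,1)`) in the two
shapes the model's `hol` binder consumes:

* `mem_holWeightForms_of_differentiableAt` — for a WEIGHT FORM `f ∈ weightForms Δ Stab(x₀) (weightOf x₀)`
  on `U(2,1)` (the group-side avatar of a `Δ`-automorphic cotangent-weight function, any section of the
  orbit map): `f ∈ holWeightForms Δ`, the `Hol` of the ball quotient's class-map datum;
* `restrictHom_mem_holWeightForms_of_differentiableAt` (and the variant `…_of_differentiableAt_mul` with the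
  hypotheses at every point of the big group) — for the ARCHIMEDEAN RESTRICTION
  `WeightForms.restrictHom ι hΔ hη F = F ∘ ι` of a weight form `F` on a group `G` (adelic points) along a
  homomorphism `ι : U(2,1) → G` with matched level and weight: it suffices that `b ↦ F(y · ι(expP b))` be
  real-differentiable at `0` with complex-linear differential, for `y` in `ι(U(2,1))` (resp. all `y ∈ G`).

The complex-linearity of the differential `D` is stated as `D(i v) = i D(v)`; in terms of the right Lie
derivatives along `𝔭` this is `X_{ib} F = i · X_b F`, i.e. annihilation of `F` by `𝔭₋ = {X_b + i X_{ib}}`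
(lower-left block; `UnitaryBallLieDerivative` gives that `C^∞` / Lie-derivative form).

References: Borel, Introduction to automorphic forms (Boulder 1966) §4; Bump, Automorphic Forms and
Representations (1997) §2.1, §3.2 (the `SL₂` prototype: lowering operator and holomorphy). Everything here is a
kernel-checked elementary consequence of `UnitaryBallCauchyRiemann`; statements are folklore.
-/

set_option autoImplicit false

noncomputable section

open scoped Matrix
open Literature.Geometry.ComplexHyperbolic Literature.Geometry.ComplexHyperbolic.BallModel
open Literature.NumberTheory.Automorphic Literature.NumberTheory.Automorphic.AutomorphyFactor

namespace Literature.AlgebraicGeometry.ShimuraVarieties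

namespace BallForms

/-- **First-order holomorphy criterion for a cotangent-weight form on `U(2,1)`.** A weight form
`f ∈ weightForms Δ Stab(x₀) (weightOf x₀)` such that, for every `g`, `b ↦ f(g · expP b)` is real-differentiable
at `0` with complex-linear differential, lies in `holWeightForms Δ` (the section of the orbit map implicit in
`holWeightForms` is irrelevant). [folklore] -/
theorem mem_holWeightForms_of_differentiableAt {Δ : Subgroup U21}
    (f : Literature.NumberTheory.Automorphic.weightForms Δ (MulAction.stabilizer U21 x₀).subtype
      (isPullbackCocycle_cotangentCocycle.weightOf x₀))
    (hd : ∀ g : U21, DifferentiableAt ℝ (fun b : Fin 2 → ℂ => (f : U21 → (Fin 2 → ℂ)) (g * expP b)) 0)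
    (hI : ∀ (g : U21) (v : Fin 2 → ℂ),
      fderiv ℝ (fun b : Fin 2 → ℂ => (f : U21 → (Fin 2 → ℂ)) (g * expP b)) 0 (Complex.I • v) =
        Complex.I • fderiv ℝ (fun b : Fin 2 → ℂ => (f : U21 → (Fin 2 → ℂ)) (g * expP b)) 0 v) :
    f ∈ holWeightForms Δ isPullbackCocycle_cotangentCocycle := by
  obtain ⟨s, hsec⟩ : ∃ s : Ball → U21, ∀ z, s z • x₀ = z :=
    ⟨fun z => (exists_smul_x₀_eq z).choose, fun z => (exists_smul_x₀_eq z).choose_spec⟩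
  rw [mem_holWeightForms_iff isPullbackCocycle_cotangentCocycle hsec]
  have hF : toGroupFun cotangentCocycle x₀
      (((factorFormsEquiv isPullbackCocycle_cotangentCocycle hsec).symm f :
        factorForms Δ cotangentCocycle) : Ball → (Fin 2 → ℂ)) = (f : U21 → (Fin 2 → ℂ)) :=
    congrArg
      (fun g : Literature.NumberTheory.Automorphic.weightForms Δ (MulAction.stabilizer U21 x₀).subtype
        (isPullbackCocycle_cotangentCocycle.weightOf x₀) => (g : U21 → (Fin 2 → ℂ)))
      (toGroup_ofGroup isPullbackCocycle_cotangentCocycle hsec f)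
  refine mem_holomorphic_of_cauchyRiemann _ (fun g => ?_) (fun g v => ?_)
  · rw [hF]; exact hd g
  · rw [hF]; exact hI g v

/-- **First-order holomorphy criterion for an archimedean restriction.** Let `ι : U(2,1) → G` be a
homomorphism along which level and weight are matched (`WeightForms.IsLevelCorrected`, `IsWeightMatched`,
cotangent weight at `x₀`) and `F` a weight form on `G`. If for every `x ∈ U(2,1)` the function
`b ↦ F(ι x · ι(expP b))` is real-differentiable at `b = 0` with complex-linear differential, then the
restricted form `F ∘ ι = WeightForms.restrictHom ι hΔ hη F` lies in `holWeightForms Δ`. [folklore] -/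
theorem restrictHom_mem_holWeightForms_of_differentiableAt {G Kc : Type*} [Group G] [Group Kc]
    {ΓU : Subgroup G} {κ : Kc →* G} {τ : Representation ℂ Kc (Fin 2 → ℂ)} (ι : U21 →* G)
    {Δ : Subgroup U21} (hΔ : WeightForms.IsLevelCorrected ΓU κ τ ι Δ)
    {η₁ : MulAction.stabilizer U21 x₀ →* Kc}
    (hη : WeightForms.IsWeightMatched κ τ ι (MulAction.stabilizer U21 x₀).subtype
      (isPullbackCocycle_cotangentCocycle.weightOf x₀) η₁)
    (F : Literature.NumberTheory.Automorphic.weightForms ΓU κ τ)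
    (hd : ∀ x : U21,
      DifferentiableAt ℝ (fun b : Fin 2 → ℂ => (F : G → (Fin 2 → ℂ)) (ι x * ι (expP b))) 0)
    (hI : ∀ (x : U21) (v : Fin 2 → ℂ),
      fderiv ℝ (fun b : Fin 2 → ℂ => (F : G → (Fin 2 → ℂ)) (ι x * ι (expP b))) 0 (Complex.I • v) =
        Complex.I • fderiv ℝ (fun b : Fin 2 → ℂ => (F : G → (Fin 2 → ℂ)) (ι x * ι (expP b))) 0 v) :
    WeightForms.restrictHom ι hΔ hη F ∈ holWeightForms Δ isPullbackCocycle_cotangentCocycle := by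
  have hfun : ∀ x : U21,
      (fun b : Fin 2 → ℂ => (WeightForms.restrictHom ι hΔ hη F : U21 → (Fin 2 → ℂ)) (x * expP b)) =
        fun b : Fin 2 → ℂ => (F : G → (Fin 2 → ℂ)) (ι x * ι (expP b)) := by
    intro x
    funext b
    show (F : G → (Fin 2 → ℂ)) (ι (x * expP b)) = (F : G → (Fin 2 → ℂ)) (ι x * ι (expP b))
    rw [map_mul]
  refine mem_holWeightForms_of_differentiableAt _ (fun x => ?_) (fun x v => ?_)
  · rw [hfun x]; exact hd x
  · rw [hfun x]; exact hI x v

/-- **First-order holomorphy criterion for an archimedean restriction, hypotheses on all of `G`.** As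
`restrictHom_mem_holWeightForms_of_differentiableAt`, with the differentiability and the complex-linearity
of the differential of `b ↦ F(y · ι(expP b))` at `0` assumed at every `y ∈ G` (the natural output of a
termwise differentiation of an adelic theta series). [folklore] -/
theorem restrictHom_mem_holWeightForms_of_differentiableAt_mul {G Kc : Type*} [Group G] [Group Kc]
    {ΓU : Subgroup G} {κ : Kc →* G} {τ : Representation ℂ Kc (Fin 2 → ℂ)} (ι : U21 →* G)
    {Δ : Subgroup U21} (hΔ : WeightForms.IsLevelCorrected ΓU κ τ ι Δ)
    {η₁ : MulAction.stabilizer U21 x₀ →* Kc}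
    (hη : WeightForms.IsWeightMatched κ τ ι (MulAction.stabilizer U21 x₀).subtype
      (isPullbackCocycle_cotangentCocycle.weightOf x₀) η₁)
    (F : Literature.NumberTheory.Automorphic.weightForms ΓU κ τ)
    (hd : ∀ y : G, DifferentiableAt ℝ (fun b : Fin 2 → ℂ => (F : G → (Fin 2 → ℂ)) (y * ι (expP b))) 0)
    (hI : ∀ (y : G) (v : Fin 2 → ℂ),
      fderiv ℝ (fun b : Fin 2 → ℂ => (F : G → (Fin 2 → ℂ)) (y * ι (expP b))) 0 (Complex.I • v) =
        Complex.I • fderiv ℝ (fun b : Fin 2 → ℂ => (F : G → (Fin 2 → ℂ)) (y * ι (expP b))) 0 v) :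
    WeightForms.restrictHom ι hΔ hη F ∈ holWeightForms Δ isPullbackCocycle_cotangentCocycle :=
  restrictHom_mem_holWeightForms_of_differentiableAt ι hΔ hη F (fun x => hd (ι x)) fun x v => hI (ι x) v

end BallForms

end Literature.AlgebraicGeometry.ShimuraVarieties

end
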